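import Summits.QuantumAdvantage.QuantumAdvantage.Theorems.InnerDegreeLawsJ

set_option linter.dupNamespace false

/-!
# InnerDegreeLawsK (lens 4, g27; part K = LAND-PACKAGE-8) — the OFF-DIAGONAL RANK LEMMA: if every block with disjoint row and column index sets has rank ≤ r, the matrix agrees off the diagonal and off ≤ 2r exceptional lines with a matrix of rank ≤ r (maximal disjoint invertible minor + Schur complements) — kernel piece (P8) of the paper proof of (c0)

Blocker `X = AbsorptionDial.NoPerfectPolyOdd` (item 28487); decomp-qadv lens 4 (minimal-counterexample / extremal reduction), g27.  The NODE record
(rung `QuadFormNoPerfectOdd`, residual `QuadLiftOdd`, sub-rung `OneQuadNoPerfectOdd`, floor `linFormFloor`, `x_iff_pieces`) lives in the cell file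
`g27/InnerDegreeDial.lean` and is NOT landed (Prop-definition node pieces); the tree parts are Prop-definition-free and state only unconditional LAWS.
Parts A–J are LANDED (p825604/p825613/p825616/p825666/p826280/p826399/p826805/p827092/p827532/p827881; LAW C/Q/E/S/C⁺, first-moment subcubes,
deletion identity, normal form, LAW R, MOD_p / affine rectangle kills, saturated regime, its symmetry group, row tables, one-sided saturation); part K is the
LAND-PACKAGE-8 delta (imports part J for lineage only; its content is pure Mathlib linear algebra).  Kernel-checked content:

* §18 **off-diagonal rank lemma** (NODE10, (P8) of the paper proof (xi) of (c0)): every block with disjoint row/column sets of rank `≤ r`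
  ⇒ `Q i j = R i j` for `i ≠ j` off `≤ 2r` exceptional lines, `rank R ≤ r` (`offDiag_lowRank`, `offDiag_lowRank_finset`; maximal disjoint
  invertible minor + Schur complements `Matrix.det_fromBlocks₁₁`).
-/

open Finset
open Summit.QuantumAdvantage.AdviceFreeQNC0

namespace Summit.QuantumAdvantage.QuantumAdvantage.Theorems.InnerDegreeDial

/-! ### §18 the OFF-DIAGONAL RANK LEMMA (NODE10 §3 (c0)(xi) (P8)): all disjoint blocks of rank ≤ r ⇒ rank-≤-r + diagonal + ≤ 2r lines

Pure linear algebra over a field, used in the closing dichotomy of (c0): if EVERY block `Q[X, Y]` with DISJOINT row and column index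
sets has rank `≤ r`, then `Q` agrees, off the diagonal and off the `≤ 2r` lines of an exceptional set `Z`, with a matrix `R` of rank
`≤ r` (`offDiag_lowRank`, `offDiag_lowRank_finset`).  Proof: a disjoint invertible minor `Q[f, g]` of MAXIMAL size `s ≤ r`
(`Nat.findGreatest` over «injective `f g : Fin s → ι` with disjoint ranges and `IsUnit (Q.submatrix f g).det`»); for `i ≠ j` outside
its lines the `(i, j)`-bordering is again a disjoint minor, so its Schur complement `Q i j − Q[i, g] Q[f, g]⁻¹ Q[f, j]` vanishes
(`disjInvMinor_succ_of_ne`, `Matrix.det_fromBlocks₁₁`), i.e. `Q i j = (Q[·, g] Q[f,g]⁻¹ Q[f, ·]) i j`.  In the paper argument (xi) this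
turns «no dispersing bipartition of the column half» (every cross block of `M + Mᵀ` of rank `≤ r₀ = polylog` by the dispersion inverse
theorem) into «`uᵀ M u` is a function of `O(r₀)` linear forms on the cube», whence COUNTING. -/
section OffDiagRank

open Matrix

variable {K : Type*} [Field K] {ι : Type*}

/-- Bordering: if the Schur complement of the `(i, j)` bordering of a disjoint invertible minor
is nonzero, the bordered minor is a disjoint invertible minor of size `s + 1` (injective index maps
with disjoint ranges and a unit determinant). -/
theorem disjInvMinor_succ_of_ne (Q : Matrix ι ι K) {s : ℕ} {f g : Fin s → ι}
    (hf : Function.Injective f) (hg : Function.Injective g) (hfg : ∀ a b, f a ≠ g b)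
    (hA : IsUnit (Q.submatrix f g).det) {i j : ι} (hij : i ≠ j)
    (hi : i ∉ Set.range f) (hi' : i ∉ Set.range g) (hj' : j ∉ Set.range f)
    (hj : j ∉ Set.range g)
    (hne : Q i j ≠ ((Q.submatrix (fun _ : Unit => i) g) * (Q.submatrix f g)⁻¹ *
      (Q.submatrix f (fun _ : Unit => j))) () ()) :
    ∃ f' g' : Fin (s + 1) → ι, Function.Injective f' ∧ Function.Injective g' ∧
      (∀ a b, f' a ≠ g' b) ∧ IsUnit (Q.submatrix f' g').det := by
  classical
  set A : Matrix (Fin s) (Fin s) K := Q.submatrix f g with hAdef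
  let F : Fin s ⊕ Unit → ι := Sum.elim f (fun _ => i)
  let G : Fin s ⊕ Unit → ι := Sum.elim g (fun _ => j)
  have hF : Function.Injective F :=
    hf.sumElim (Function.injective_of_subsingleton _) (fun a _ h => hi ⟨a, h⟩)
  have hG : Function.Injective G :=
    hg.sumElim (Function.injective_of_subsingleton _) (fun a _ h => hj ⟨a, h⟩)
  have hFG : ∀ a b, F a ≠ G b := by
    rintro (a | a) (b | b)
    · exact hfg a b
    · intro h; exact hj' ⟨a, by simpa [F, G] using h⟩
    · intro h; exact hi' ⟨b, by simpa [F, G] using h.symm⟩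
    · simpa [F, G] using hij
  have hB : Q.submatrix F G = Matrix.fromBlocks A (Q.submatrix f fun _ : Unit => j)
      (Q.submatrix (fun _ : Unit => i) g) (Q.submatrix (fun _ : Unit => i) fun _ : Unit => j) := by
    ext (a | a) (b | b) <;> rfl
  haveI : Invertible A := Matrix.invertibleOfIsUnitDet A hA
  have hdet : (Q.submatrix F G).det ≠ 0 := by
    rw [hB, Matrix.det_fromBlocks₁₁]
    refine mul_ne_zero hA.ne_zero ?_
    rw [Matrix.det_unique, Matrix.sub_apply, Matrix.invOf_eq_nonsing_inv]
    exact sub_ne_zero.mpr hne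
  have e : Fin (s + 1) ≃ (Fin s ⊕ Unit) := Fintype.equivOfCardEq (by simp)
  refine ⟨F ∘ e, G ∘ e, hF.comp e.injective, hG.comp e.injective, fun a b => hFG _ _, ?_⟩
  have : Q.submatrix (F ∘ e) (G ∘ e) = (Q.submatrix F G).submatrix e e := rfl
  rw [this, Matrix.det_submatrix_equiv_self]
  exact isUnit_iff_ne_zero.mpr hdet

/-- **Off-diagonal rank lemma.**  If every block of `Q` with disjoint (injectively indexed) row
and column sets has rank `≤ r`, then there are index maps `f g : Fin s → ι`, `s ≤ r`, and a
matrix `R` of rank `≤ s` such that `Q i j = R i j` whenever `i ≠ j` lie outside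
`range f ∪ range g`.  (So `Q = R + diagonal + E` with `E` supported on the `≤ 2s` lines of
`range f ∪ range g`.) -/
theorem offDiag_lowRank [Fintype ι] (Q : Matrix ι ι K) (r : ℕ)
    (hQ : ∀ (s : ℕ) (f g : Fin s → ι), Function.Injective f → Function.Injective g →
      (∀ a b, f a ≠ g b) → (Q.submatrix f g).rank ≤ r) :
    ∃ (s : ℕ) (f g : Fin s → ι) (R : Matrix ι ι K), s ≤ r ∧ R.rank ≤ s ∧
      Function.Injective f ∧ Function.Injective g ∧
      ∀ i j, i ≠ j → i ∉ Set.range f → i ∉ Set.range g → j ∉ Set.range f → j ∉ Set.range g →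
        Q i j = R i j := by
  classical
  -- `P s`: a disjoint invertible minor of size `s` exists
  let P : ℕ → Prop := fun s => ∃ f g : Fin s → ι, Function.Injective f ∧ Function.Injective g ∧
    (∀ a b, f a ≠ g b) ∧ IsUnit (Q.submatrix f g).det
  have hP0 : P 0 := by
    refine ⟨Fin.elim0, Fin.elim0, fun a => a.elim0, fun a => a.elim0, fun a => a.elim0, ?_⟩
    simp [Matrix.det_isEmpty]
  set s := Nat.findGreatest P (Fintype.card ι) with hs
  have hP : P s := Nat.findGreatest_spec (P := P) (Nat.zero_le _) hP0
  have hmax : ¬ P (s + 1) := by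
    intro h
    by_cases hle : s + 1 ≤ Fintype.card ι
    · exact Nat.findGreatest_is_greatest (Nat.lt_succ_self _) hle h
    · obtain ⟨f', -, hf', -, -, -⟩ := h
      have := Fintype.card_le_of_injective f' hf'
      simp only [Fintype.card_fin] at this
      omega
  obtain ⟨f, g, hf, hg, hfg, hA⟩ := hP
  refine ⟨s, f, g, (Q.submatrix id g) * (Q.submatrix f g)⁻¹ * (Q.submatrix f id), ?_, ?_,
    hf, hg, ?_⟩
  · have h1 := hQ s f g hf hg hfg
    have h2 : (Q.submatrix f g).rank = s := by
      rw [Matrix.rank_of_isUnit _ ((Matrix.isUnit_iff_isUnit_det _).mpr hA), Fintype.card_fin]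
    omega
  · calc ((Q.submatrix id g) * (Q.submatrix f g)⁻¹ * (Q.submatrix f id)).rank
        ≤ ((Q.submatrix id g) * (Q.submatrix f g)⁻¹).rank := Matrix.rank_mul_le_left _ _
      _ ≤ Fintype.card (Fin s) := Matrix.rank_le_card_width _
      _ = s := Fintype.card_fin s
  · intro i j hij hi hi' hj' hj
    by_contra hne
    apply hmax
    refine disjInvMinor_succ_of_ne Q hf hg hfg hA hij hi hi' hj' hj ?_
    intro h
    apply hne
    rw [h]
    simp [Matrix.mul_apply]

/-- Finset form of `offDiag_lowRank`: an exceptional set `Z` of at most `2r` indices and a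
matrix `R` of rank `≤ r` with `Q i j = R i j` for all `i ≠ j` outside `Z`. -/
theorem offDiag_lowRank_finset [Fintype ι] (Q : Matrix ι ι K) (r : ℕ)
    (hQ : ∀ (s : ℕ) (f g : Fin s → ι), Function.Injective f → Function.Injective g →
      (∀ a b, f a ≠ g b) → (Q.submatrix f g).rank ≤ r) :
    ∃ (Z : Finset ι) (R : Matrix ι ι K), Z.card ≤ 2 * r ∧ R.rank ≤ r ∧
      ∀ i j, i ≠ j → i ∉ Z → j ∉ Z → Q i j = R i j := by
  classical
  obtain ⟨s, f, g, R, hs, hR, hf, hg, h⟩ := offDiag_lowRank Q r hQ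
  refine ⟨Finset.univ.image f ∪ Finset.univ.image g, R, ?_, hR.trans hs, ?_⟩
  · calc (Finset.univ.image f ∪ Finset.univ.image g).card
        ≤ (Finset.univ.image f).card + (Finset.univ.image g).card := Finset.card_union_le _ _
      _ ≤ Finset.univ.card + Finset.univ.card :=
          add_le_add Finset.card_image_le Finset.card_image_le
      _ = 2 * s := by simp [Finset.card_univ, Fintype.card_fin]; ring
      _ ≤ 2 * r := by omega
  · intro i j hij hi hj
    refine h i j hij ?_ ?_ ?_ ?_
    · rintro ⟨a, rfl⟩
      exact hi (Finset.mem_union_left _ (Finset.mem_image_of_mem f (Finset.mem_univ a)))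
    · rintro ⟨a, rfl⟩
      exact hi (Finset.mem_union_right _ (Finset.mem_image_of_mem g (Finset.mem_univ a)))
    · rintro ⟨a, rfl⟩
      exact hj (Finset.mem_union_left _ (Finset.mem_image_of_mem f (Finset.mem_univ a)))
    · rintro ⟨a, rfl⟩
      exact hj (Finset.mem_union_right _ (Finset.mem_image_of_mem g (Finset.mem_univ a)))

end OffDiagRank

end Summit.QuantumAdvantage.QuantumAdvantage.Theorems.InnerDegreeDial
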